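import Summits.KontsevichZagierPeriods.KontsevichZagierPeriods.Theorems.RealEllipticSectorKernel.Negative.Core
import Summits.KontsevichZagierPeriods.KontsevichZagierPeriods.Theorems.EllipticMomentKernel.Negative.GeneralCurve
import Summits.KontsevichZagierPeriods.KontsevichZagierPeriods.Theorems.GenusTwoCycleTransfer.Negative.Witnesses
import Literature.NumberTheory.Transcendental.KZKernelConjectureForms

/-!
# Disproof companion workfile — `RealEllipticSectorKernel` (stmt-KontsevichZagierPeriods-10632), F13–F14:
# the route's own CM test curve `y² = 4x³ − 120x + 224` (`j = 8000`)

Companion of `Disproof.lean` (§§12–13 moved here: the crux dir caps a workfile at 200 kB). cdisprove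
seat, cycle 3. Everything is sorry-free, axioms ⊆ {propext, Classical.choice, Quot.sound}; it is
written over the LANDED vocabulary `…RealEllipticSectorKernel.Negative.{cubic, σ₁, σ₂, J₀, J₁, K₀, K₁,
Rigidity}` (identical to `Disproof.lean`'s own copies) so that the landing twins
`Negative/RootsCM8000.lean`, `Negative/IsogenyCM8000.lean`, `Negative/CMPoint8000.lean`,
`Negative/SecondKindCM8000.lean`, `Negative/CMPoint8000SecondKind.lean` are verbatim extracts.

F13. The `x`-coordinate of the CM isogeny `[√−2]` is the REAL RATIONAL map `Φ(x) = −x/2 − 9/(x−4)`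
with `f(Φx) = −f(x)·Φ′(x)²/2` exactly; `Φ − r₂ = −(x − x*)²/(2(x − 4))`, `x* = 4 − 3√2`, so `Φ` folds
the oval `(r₃, r₂)` (`r₂,₃ = −2 ± 3√2`) at `x*` and maps each half injectively onto `σ' = (r₂, 4)`
with weight `|Φ′|/√(−f∘Φ) = √2/√f`; two changes of variables + additivity over the fold give
`J₀(120,−224) = √2·K₀(120,−224)` with NO transcendence ⇒ `¬Rigidity 120 (−224)` (crux vacuous at the
route's own CM curve, IRRATIONAL algebraic coefficient — no integer relation between `J₀, K₀`,
`Sharpened` untouched) and the value identity of item 3415 (`CMTwistPeriodTransfer` is a summit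
corollary; its negation refutes the summit).

F14. Pulling `u du/√(−f)` back through `Φ` and ONE Hermite step across the branch points with
`G = √f/(x − 4)` give `K₁(120,−224) = √2·J₀ − J₁/√2` exactly (Masser's Lemma 3.1, `κ ≠ 0`) ⇒ a second
independent algebraic relation `(√2/2)J₁ − 2K₀ + K₁ = 0` and the value identity of item 3416
(`CMTwistQuasiPeriodTransfer` is a summit corollary).
-/

noncomputable section

namespace Summit.KontsevichZagierPeriods.RealEllipticSectorKernel.CM8000

open MeasureTheory Set

/-- `f = 4x³ − 120x + 224`. [folklore] -/
def f8 (x : ℝ) : ℝ := 4 * x ^ 3 - 120 * x + 224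

/-- `r₂ = −2 + 3√2` (the middle root). [folklore] -/
def r₂ : ℝ := -2 + 3 * Real.sqrt 2

/-- `r₃ = −2 − 3√2` (the smallest root). [folklore] -/
def r₃ : ℝ := -2 - 3 * Real.sqrt 2

/-- `x* = 4 − 3√2` (the fold point of `Φ` on the oval). [folklore] -/
def xs : ℝ := 4 - 3 * Real.sqrt 2

/-- Auxiliary numerics. [folklore] -/
theorem sqrt2_sq : Real.sqrt 2 ^ 2 = 2 := Real.sq_sqrt (by norm_num)

/-- Auxiliary numerics. [folklore] -/
theorem sqrt2_gt : (1.41 : ℝ) < Real.sqrt 2 := by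
  rw [show (1.41 : ℝ) = Real.sqrt (1.41 ^ 2) by rw [Real.sqrt_sq (by norm_num)]]
  exact Real.sqrt_lt_sqrt (by norm_num) (by norm_num)

/-- Auxiliary numerics. [folklore] -/
theorem sqrt2_lt : Real.sqrt 2 < (1.42 : ℝ) := by
  rw [show (1.42 : ℝ) = Real.sqrt (1.42 ^ 2) by rw [Real.sqrt_sq (by norm_num)]]
  exact Real.sqrt_lt_sqrt (by norm_num) (by norm_num)

/-- `(x − r₂)(x − r₃) = x² + 4x − 14`. [folklore] -/
theorem quad_factor (x : ℝ) : (x - r₂) * (x - r₃) = x ^ 2 + 4 * x - 14 := by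
  unfold r₂ r₃; nlinarith [sqrt2_sq]

/-- `f = 4(x − 4)(x − r₂)(x − r₃)`. [folklore] -/
theorem f8_factor (x : ℝ) : f8 x = 4 * (x - 4) * ((x - r₂) * (x - r₃)) := by
  rw [quad_factor]; unfold f8; ring

/-- The factorisation in the shape of the EMK root lemmas: `cubic 120 (−224) = 4(x−r₃)(x−r₂)(x−4)`.
[folklore] -/
theorem cubic_eq (x : ℝ) :
    Summit.KontsevichZagierPeriods.HermiteRigidity.EllipticMomentKernelNegative.cubic 120 (-224) x =
      4 * (x - r₃) * (x - r₂) * (x - 4) := by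
  have h := f8_factor x
  unfold f8 at h
  simp only [Summit.KontsevichZagierPeriods.HermiteRigidity.EllipticMomentKernelNegative.cubic]
  push_cast
  linarith [h, show 4 * (x - 4) * ((x - r₂) * (x - r₃)) = 4 * (x - r₃) * (x - r₂) * (x - 4) by ring]

/-- `cubic 120 (−224) = f` (the crux's `cubic`). [folklore] -/
theorem cubic_eq_f8 (x : ℝ) : Negative.cubic 120 (-224) x = f8 x := by
  simp only [Negative.cubic, f8]; push_cast; ring

/-- `cubic 120 (−224) = f` (EMK's copy of `cubic`). [folklore] -/
theorem cubic_eq_f8' (x : ℝ) :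
    Summit.KontsevichZagierPeriods.HermiteRigidity.EllipticMomentKernelNegative.cubic 120 (-224) x = f8 x := by
  simp only [Summit.KontsevichZagierPeriods.HermiteRigidity.EllipticMomentKernelNegative.cubic, f8]
  push_cast; ring

/-- `r₃ < x*`. [folklore] -/
theorem r₃_lt_xs : r₃ < xs := by unfold r₃ xs; nlinarith [sqrt2_gt]
/-- `x* < r₂`. [folklore] -/
theorem xs_lt_r₂ : xs < r₂ := by unfold r₂ xs; nlinarith [sqrt2_gt]
/-- `r₂ < 4`. [folklore] -/
theorem r₂_lt_four : r₂ < 4 := by unfold r₂; nlinarith [sqrt2_lt]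
/-- `r₃ < r₂`. [folklore] -/
theorem r₃_lt_r₂ : r₃ < r₂ := r₃_lt_xs.trans xs_lt_r₂
/-- `x* < 0`. [folklore] -/
theorem xs_lt_zero : xs < 0 := by unfold xs; nlinarith [sqrt2_gt]
/-- `0 < r₂`. [folklore] -/
theorem zero_lt_r₂ : 0 < r₂ := by unfold r₂; nlinarith [sqrt2_gt]
/-- `r₃ < 0`. [folklore] -/
theorem r₃_lt_zero : r₃ < 0 := by unfold r₃; nlinarith [sqrt2_gt]

/-- `f > 0` on the oval `(r₃, r₂)`. [folklore] -/
theorem f8_pos_of_mem {x : ℝ} (h3 : r₃ < x) (h2 : x < r₂) : 0 < f8 x := by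
  rw [f8_factor, show 4 * (x - 4) * ((x - r₂) * (x - r₃)) = 4 * (4 - x) * ((r₂ - x) * (x - r₃)) by ring]
  have h1 : 0 < 4 - x := by linarith [r₂_lt_four]
  have h2' : 0 < r₂ - x := by linarith
  have h3' : 0 < x - r₃ := by linarith
  positivity

/-- `f < 0` on `σ' = (r₂, 4)`. [folklore] -/
theorem f8_neg_of_mem {x : ℝ} (h2 : r₂ < x) (h4 : x < 4) : f8 x < 0 := by
  rw [f8_factor]
  have h1 : 0 < 4 - x := by linarith
  have h2' : 0 < x - r₂ := by linarith
  have h3' : 0 < x - r₃ := by linarith [r₃_lt_r₂]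
  have : 0 < 4 * (4 - x) * ((x - r₂) * (x - r₃)) := by positivity
  linarith

/-- The typed oval at `(120,−224)`: `{0 < f ∧ ∃ t > x, f t < 0} = (r₃, r₂)`. [folklore] -/
theorem sigma_iff (x : ℝ) : (0 < f8 x ∧ ∃ t : ℝ, x < t ∧ f8 t < 0) ↔ r₃ < x ∧ x < r₂ := by
  constructor
  · rintro ⟨hx, t, hxt, hft⟩
    have hx' := hx
    rw [← cubic_eq_f8] at hx'
    rcases Summit.KontsevichZagierPeriods.HermiteRigidity.EllipticMomentKernelNegative.mem_Ioo_or_gt_of_cubic_pos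
      r₃_lt_r₂ r₂_lt_four cubic_eq hx' with h | h
    · exact h
    · have hft' := hft
      rw [← cubic_eq_f8] at hft'
      exact absurd hft' (not_lt.2
        (Summit.KontsevichZagierPeriods.HermiteRigidity.EllipticMomentKernelNegative.cubic_pos_of_gt
          r₃_lt_r₂ r₂_lt_four cubic_eq (h.trans hxt)).le)
  · rintro ⟨h3, h2⟩
    exact ⟨f8_pos_of_mem h3 h2, 3, by linarith [r₂_lt_four, h2, show r₂ < 3 by unfold r₂; nlinarith [sqrt2_lt]],
      f8_neg_of_mem (by unfold r₂; nlinarith [sqrt2_lt]) (by norm_num)⟩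

/-- `f < 0` forces `x < r₃ ∨ (r₂ < x < 4)`. [folklore] -/
theorem of_f8_neg {x : ℝ} (hx : f8 x < 0) : x < r₃ ∨ (r₂ < x ∧ x < 4) := by
  by_contra hcon
  push Not at hcon
  obtain ⟨h3, h24⟩ := hcon
  rcases lt_or_ge x r₂ with h2 | h2
  · rcases h3.lt_or_eq with h3 | h3
    · linarith [f8_pos_of_mem h3 h2]
    · subst h3
      rw [f8_factor] at hx; simp at hx
  · rcases h2.lt_or_eq with h2 | h2
    · have h4 := h24 h2
      rcases h4.lt_or_eq with h4 | h4
      · have := Summit.KontsevichZagierPeriods.HermiteRigidity.EllipticMomentKernelNegative.cubic_pos_of_gt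
          r₃_lt_r₂ r₂_lt_four cubic_eq h4
        rw [cubic_eq_f8'] at this; linarith
      · subst h4; rw [f8_factor] at hx; simp at hx
    · subst h2; rw [f8_factor] at hx; simp at hx

/-- The typed `σ'` at `(120,−224)`: `{f < 0 ∧ ∃ t < x, 0 < f t} = (r₂, 4)`. [folklore] -/
theorem sigma'_iff (x : ℝ) : (f8 x < 0 ∧ ∃ t : ℝ, t < x ∧ 0 < f8 t) ↔ r₂ < x ∧ x < 4 := by
  constructor
  · rintro ⟨hx, t, htx, hft⟩
    rcases of_f8_neg hx with h | h
    · exfalso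
      have hft' := hft
      rw [← cubic_eq_f8] at hft'
      rcases Summit.KontsevichZagierPeriods.HermiteRigidity.EllipticMomentKernelNegative.mem_Ioo_or_gt_of_cubic_pos
        r₃_lt_r₂ r₂_lt_four cubic_eq hft' with ht | ht
      · linarith [ht.1]
      · linarith [r₃_lt_r₂, r₂_lt_four]
    · exact h
  · rintro ⟨h2, h4⟩
    exact ⟨f8_neg_of_mem h2 h4, 0, by linarith [zero_lt_r₂], f8_pos_of_mem r₃_lt_zero zero_lt_r₂⟩

/-- `{f < 0 ∧ 0 < x} = (r₂, 4)` (the `σ'` of support item `CMTwistPeriodTransfer`). [folklore] -/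
theorem sigma'_iff' (x : ℝ) : (f8 x < 0 ∧ 0 < x) ↔ r₂ < x ∧ x < 4 := by
  constructor
  · rintro ⟨hx, h0⟩
    rcases of_f8_neg hx with h | h
    · linarith [r₃_lt_zero]
    · exact h
  · rintro ⟨h2, h4⟩
    exact ⟨f8_neg_of_mem h2 h4, zero_lt_r₂.trans h2⟩

/-- `{0 < f ∧ x < 4} = (r₃, r₂)` (the `σ` of support item `CMTwistPeriodTransfer`). [folklore] -/
theorem sigma_iff' (x : ℝ) : (0 < f8 x ∧ x < 4) ↔ r₃ < x ∧ x < r₂ := by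
  constructor
  · rintro ⟨hx, h4⟩
    have hx' := hx
    rw [← cubic_eq_f8] at hx'
    rcases Summit.KontsevichZagierPeriods.HermiteRigidity.EllipticMomentKernelNegative.mem_Ioo_or_gt_of_cubic_pos
      r₃_lt_r₂ r₂_lt_four cubic_eq hx' with h | h
    · exact h
    · linarith
  · rintro ⟨h3, h2⟩
    exact ⟨f8_pos_of_mem h3 h2, h2.trans r₂_lt_four⟩

/-! ### The CM isogeny substitution `Φ(x) = −x/2 − 9/(x − 4)` -/

/-- `Φ(x) = −x/2 − 9/(x − 4)` (x-coordinate of `[√−2]`, real and rational). [folklore] -/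
def Φ (x : ℝ) : ℝ := -x / 2 - 9 / (x - 4)

/-- `Φ′(x) = −1/2 + 9/(x − 4)²`. [folklore] -/
def Φ' (x : ℝ) : ℝ := -1 / 2 + 9 / (x - 4) ^ 2

/-- `Φ` has derivative `Φ′` off `x = 4`. [folklore] -/
theorem hasDerivAt_Φ {x : ℝ} (hx : x ≠ 4) : HasDerivAt Φ (Φ' x) x := by
  have hx' : x - 4 ≠ 0 := sub_ne_zero.mpr hx
  have h1 : HasDerivAt (fun y : ℝ => y - 4) 1 x := (hasDerivAt_id' x).sub_const 4
  have h2 : HasDerivAt (fun y : ℝ => (y - 4)⁻¹) (-(1 : ℝ) / (x - 4) ^ 2) x := h1.inv hx'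
  have h3 : HasDerivAt (fun y : ℝ => -y / 2 - 9 * (y - 4)⁻¹)
      (-(1 : ℝ) / 2 - 9 * (-(1 : ℝ) / (x - 4) ^ 2)) x :=
    ((hasDerivAt_id' x).neg.div_const 2).sub (h2.const_mul 9)
  have e : Φ = fun y : ℝ => -y / 2 - 9 * (y - 4)⁻¹ := by
    ext y; simp only [Φ, div_eq_mul_inv]
  rw [e]
  convert h3 using 1
  unfold Φ'
  field_simp
  ring

/-- **The weight identity of the CM isogeny**: `f(Φx) = −f(x)·Φ′(x)²/2`. [folklore] -/
theorem Φ_key {x : ℝ} (hx : x ≠ 4) : f8 (Φ x) = -(f8 x) * Φ' x ^ 2 / 2 := by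
  have hx' : x - 4 ≠ 0 := sub_ne_zero.mpr hx
  unfold f8 Φ Φ'
  field_simp
  ring

/-- `Φ(x) − 4 = −(x−r₂)(x−r₃)/(2(x−4))`: the oval maps to the left of `4`. [folklore] -/
theorem Φ_sub_four {x : ℝ} (hx : x ≠ 4) : Φ x - 4 = -((x - r₂) * (x - r₃)) / (2 * (x - 4)) := by
  have hx' : x - 4 ≠ 0 := sub_ne_zero.mpr hx
  rw [quad_factor]; unfold Φ; field_simp; ring

/-- `Φ(x) − r₂ = −(x−x*)²/(2(x−4))`: a perfect square, so `Φ ≥ r₂` with equality at the fold. [folklore] -/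
theorem Φ_sub_r₂ {x : ℝ} (hx : x ≠ 4) : Φ x - r₂ = -((x - xs) ^ 2) / (2 * (x - 4)) := by
  have hx' : x - 4 ≠ 0 := sub_ne_zero.mpr hx
  unfold Φ r₂ xs; field_simp; nlinarith [sqrt2_sq]

/-- `Φ(r₂) = 4`. [folklore] -/
theorem Φ_r₂ : Φ r₂ = 4 := by
  have h := Φ_sub_four r₂_lt_four.ne; simp at h; linarith
/-- `Φ(r₃) = 4`. [folklore] -/
theorem Φ_r₃ : Φ r₃ = 4 := by
  have h := Φ_sub_four (r₃_lt_r₂.trans r₂_lt_four).ne; simp at h; linarith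
/-- `Φ(x*) = r₂` (the fold value). [folklore] -/
theorem Φ_xs : Φ xs = r₂ := by
  have h := Φ_sub_r₂ ((xs_lt_r₂.trans r₂_lt_four).ne); simp at h; linarith

/-- `Φ < 4` on the oval. [folklore] -/
theorem Φ_lt_four {x : ℝ} (h3 : r₃ < x) (h2 : x < r₂) : Φ x < 4 := by
  have hx4 : x < 4 := h2.trans r₂_lt_four
  have h := Φ_sub_four hx4.ne
  have hnum : (x - r₂) * (x - r₃) < 0 := mul_neg_of_neg_of_pos (by linarith) (by linarith)
  have hden : 2 * (x - 4) < 0 := by linarith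
  have : -((x - r₂) * (x - r₃)) / (2 * (x - 4)) < 0 := div_neg_of_pos_of_neg (by linarith) hden
  linarith

/-- `r₂ < Φ` to the left of `4`, off the fold point. [folklore] -/
theorem r₂_lt_Φ {x : ℝ} (hx4 : x < 4) (hxs : x ≠ xs) : r₂ < Φ x := by
  have h := Φ_sub_r₂ hx4.ne
  have hsq : 0 < (x - xs) ^ 2 := by
    have : x - xs ≠ 0 := sub_ne_zero.mpr hxs
    positivity
  have hden : 2 * (x - 4) < 0 := by linarith
  have : 0 < -((x - xs) ^ 2) / (2 * (x - 4)) := div_pos_of_neg_of_neg (by linarith) hden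
  linarith

/-- `Φ` is continuous off `x = 4`. [folklore] -/
theorem continuousOn_Φ {S : Set ℝ} (hS : ∀ x ∈ S, x ≠ 4) : ContinuousOn Φ S :=
  fun x hx => (hasDerivAt_Φ (hS x hx)).continuousAt.continuousWithinAt

/-- `Φ x = Φ y` with `x ≠ y` forces `(x − 4)(y − 4) = 18`. [folklore] -/
theorem Φ_eq_iff {x y : ℝ} (hx : x ≠ 4) (hy : y ≠ 4) (h : Φ x = Φ y) (hxy : x ≠ y) :
    (x - 4) * (y - 4) = 18 := by
  have hx' : x - 4 ≠ 0 := sub_ne_zero.mpr hx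
  have hy' : y - 4 ≠ 0 := sub_ne_zero.mpr hy
  unfold Φ at h
  field_simp at h
  have h2 : (y - x) * ((x - 4) * (y - 4) - 18) = 0 := by linear_combination h
  rcases mul_eq_zero.mp h2 with h3 | h3
  · exact absurd (by linarith : x = y) hxy
  · linarith

/-- `Φ` is injective on the left half `(r₃, x*)` (`(x−4)(y−4) > 18` there). [folklore] -/
theorem Φ_injOn₁ : InjOn Φ (Ioo r₃ xs) := by
  intro x hx y hy h
  by_contra hxy
  have key := Φ_eq_iff (by linarith [hx.2, xs_lt_r₂, r₂_lt_four]) (by linarith [hy.2, xs_lt_r₂, r₂_lt_four]) h hxy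
  have h1 : 3 * Real.sqrt 2 < 4 - x := by have := hx.2; unfold xs at this; linarith
  have h2 : 3 * Real.sqrt 2 < 4 - y := by have := hy.2; unfold xs at this; linarith
  have : 18 < (4 - x) * (4 - y) := by nlinarith [sqrt2_sq, sqrt2_gt]
  nlinarith

/-- `Φ` is injective on the right half `(x*, r₂)` (`(x−4)(y−4) < 18` there). [folklore] -/
theorem Φ_injOn₂ : InjOn Φ (Ioo xs r₂) := by
  intro x hx y hy h
  by_contra hxy
  have key := Φ_eq_iff (by linarith [hx.2, r₂_lt_four]) (by linarith [hy.2, r₂_lt_four]) h hxy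
  have h1 : 4 - x < 3 * Real.sqrt 2 := by have := hx.1; unfold xs at this; linarith
  have h1' : 0 < 4 - x := by linarith [hx.2, r₂_lt_four]
  have h2 : 4 - y < 3 * Real.sqrt 2 := by have := hy.1; unfold xs at this; linarith
  have h2' : 0 < 4 - y := by linarith [hy.2, r₂_lt_four]
  have : (4 - x) * (4 - y) < 18 := by nlinarith [sqrt2_sq, sqrt2_gt]
  nlinarith

/-- `Φ` maps the left half `(r₃, x*)` onto `σ' = (r₂, 4)`. [folklore] -/
theorem Φ_image₁ : Φ '' Ioo r₃ xs = Ioo r₂ 4 := by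
  apply Subset.antisymm
  · rintro w ⟨x, hx, rfl⟩
    exact ⟨r₂_lt_Φ (by linarith [hx.2, xs_lt_r₂, r₂_lt_four]) hx.2.ne,
      Φ_lt_four hx.1 (hx.2.trans xs_lt_r₂)⟩
  · have hcont : ContinuousOn Φ (Icc r₃ xs) :=
      continuousOn_Φ (fun x hx => by linarith [hx.2, xs_lt_r₂, r₂_lt_four])
    have h := intermediate_value_Ioo' r₃_lt_xs.le hcont
    rwa [Φ_r₃, Φ_xs] at h

/-- `Φ` maps the right half `(x*, r₂)` onto `σ' = (r₂, 4)`. [folklore] -/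
theorem Φ_image₂ : Φ '' Ioo xs r₂ = Ioo r₂ 4 := by
  apply Subset.antisymm
  · rintro w ⟨x, hx, rfl⟩
    exact ⟨r₂_lt_Φ (hx.2.trans r₂_lt_four) hx.1.ne', Φ_lt_four (r₃_lt_xs.trans hx.1) hx.2⟩
  · have hcont : ContinuousOn Φ (Icc xs r₂) :=
      continuousOn_Φ (fun x hx => by linarith [hx.2, r₂_lt_four])
    have h := intermediate_value_Ioo xs_lt_r₂.le hcont
    rwa [Φ_xs, Φ_r₂] at h

/-! ### Weights and the two changes of variables -/

/-- `|P| / √(F·P²/2) = √2/√F` for `F > 0`, `P ≠ 0`. [folklore] -/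
theorem weight_helper {F P Q : ℝ} (hF : 0 < F) (hP : P ≠ 0) (hQ : Q = F * P ^ 2 / 2) :
    |P| • (Real.sqrt Q)⁻¹ = Real.sqrt 2 * (Real.sqrt F)⁻¹ := by
  rw [smul_eq_mul, hQ, show F * P ^ 2 / 2 = (F / 2) * P ^ 2 by ring,
    Real.sqrt_mul (by positivity) (P ^ 2), Real.sqrt_sq_eq_abs, Real.sqrt_div' F zero_le_two]
  have h1 : 0 < |P| := abs_pos.mpr hP
  have h2 : 0 < Real.sqrt F := Real.sqrt_pos.mpr hF
  have h3 : 0 < Real.sqrt 2 := Real.sqrt_pos.mpr two_pos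
  field_simp

/-- `Φ′ ≠ 0` to the left of `4` off the fold point. [folklore] -/
theorem Φ'_ne {x : ℝ} (hx4 : x < 4) (hxs : x ≠ xs) : Φ' x ≠ 0 := by
  intro h
  unfold Φ' at h
  have hx' : x - 4 ≠ 0 := by linarith
  field_simp at h
  have h18 : (4 - x) ^ 2 = 18 := by nlinarith
  have hpos : 0 < 4 - x := by linarith
  have : 4 - x = 3 * Real.sqrt 2 := by
    have hs : 0 < 3 * Real.sqrt 2 := by nlinarith [sqrt2_gt]
    nlinarith [sqrt2_sq]
  exact hxs (by unfold xs; linarith)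

/-- **Jacobian weight on the oval**: `|Φ′(x)|/√(−f(Φx)) = √2/√f(x)`. [folklore] -/
theorem weight {x : ℝ} (h3 : r₃ < x) (h2 : x < r₂) (hxs : x ≠ xs) :
    |Φ' x| • (Real.sqrt (-f8 (Φ x)))⁻¹ = Real.sqrt 2 * (Real.sqrt (f8 x))⁻¹ := by
  have hx4 : x < 4 := h2.trans r₂_lt_four
  refine weight_helper (f8_pos_of_mem h3 h2) (Φ'_ne hx4 hxs) ?_
  rw [Φ_key hx4.ne]; ring

/-- `1/√f` is integrable on the oval `(r₃, r₂)` (domination by the arcsine derivative, EMK's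
`integrableOn_genIntegrand_of_roots`). [folklore] -/
theorem integrableOn_invSqrt : IntegrableOn (fun x => (Real.sqrt (f8 x))⁻¹) (Ioo r₃ r₂) := by
  have h := Summit.KontsevichZagierPeriods.HermiteRigidity.EllipticMomentKernelNegative.integrableOn_genIntegrand_of_roots
    r₃_lt_r₂ r₂_lt_four cubic_eq 0
  refine h.congr_fun (fun x _ => ?_) measurableSet_Ioo
  simp only [pow_zero, one_div, cubic_eq_f8']

/-- One change of variables per half: `∫_{σ'} du/√(−f) = √2 ∫_{half} dx/√f`, with integrability.
[folklore] -/
theorem integral_half {S : Set ℝ} (hS : MeasurableSet S) (himg : Φ '' S = Ioo r₂ 4)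
    (hinj : InjOn Φ S) (hS2 : ∀ x ∈ S, r₃ < x ∧ x < r₂ ∧ x ≠ xs) :
    ∫ u in Ioo r₂ 4, (Real.sqrt (-f8 u))⁻¹ = Real.sqrt 2 * ∫ x in S, (Real.sqrt (f8 x))⁻¹ := by
  have hder : ∀ x ∈ S, HasDerivWithinAt Φ (Φ' x) S x := fun x hx =>
    (hasDerivAt_Φ ((hS2 x hx).2.1.trans r₂_lt_four).ne).hasDerivWithinAt
  have hw : EqOn (fun x => |Φ' x| • (Real.sqrt (-f8 (Φ x)))⁻¹)
      (fun x => Real.sqrt 2 * (Real.sqrt (f8 x))⁻¹) S :=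
    fun x hx => weight (hS2 x hx).1 (hS2 x hx).2.1 (hS2 x hx).2.2
  have key := integral_image_eq_integral_abs_deriv_smul hS hder hinj (fun u => (Real.sqrt (-f8 u))⁻¹)
  rw [himg, setIntegral_congr_fun hS hw, integral_const_mul] at key
  exact key

/-- **`J = √2·K` at `j = 8000`**: `∫_{(r₃,r₂)} dx/√f = √2 ∫_{(r₂,4)} du/√(−f)` — the CM period
relation `|ω₂| = ω₁/√2` of `y² = 4x³ − 120x + 224`, by two real rational substitutions and NO
transcendence. [folklore] -/
theorem J_eq_sqrt2_mul_K :
    ∫ x in Ioo r₃ r₂, (Real.sqrt (f8 x))⁻¹ = Real.sqrt 2 * ∫ u in Ioo r₂ 4, (Real.sqrt (-f8 u))⁻¹ := by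
  have h₁ := integral_half measurableSet_Ioo Φ_image₁ Φ_injOn₁
    (fun x hx => ⟨hx.1, hx.2.trans xs_lt_r₂, hx.2.ne⟩)
  have h₂ := integral_half measurableSet_Ioo Φ_image₂ Φ_injOn₂
    (fun x hx => ⟨r₃_lt_xs.trans hx.1, hx.2, hx.1.ne'⟩)
  -- split the oval at the fold point
  have hsplit : Ioo r₃ r₂ = Ioc r₃ xs ∪ Ioo xs r₂ := (Ioc_union_Ioo_eq_Ioo r₃_lt_xs.le xs_lt_r₂).symm
  have hdisj : Disjoint (Ioc r₃ xs) (Ioo xs r₂) := by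
    rw [Set.disjoint_iff]; rintro x ⟨h1, h2⟩; exact (lt_irrefl _ (h1.2.trans_lt h2.1)).elim
  have hint := integrableOn_invSqrt
  rw [hsplit, setIntegral_union hdisj measurableSet_Ioo (hint.mono_set (by rw [hsplit]; exact subset_union_left))
    (hint.mono_set (by rw [hsplit]; exact subset_union_right)), integral_Ioc_eq_integral_Ioo]
  have hs2 : Real.sqrt 2 * Real.sqrt 2 = 2 := Real.mul_self_sqrt zero_le_two
  have hs : Real.sqrt 2 ≠ 0 := by positivity
  set A := ∫ x in Ioo r₃ xs, (Real.sqrt (f8 x))⁻¹ with hA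
  set B := ∫ x in Ioo xs r₂, (Real.sqrt (f8 x))⁻¹ with hB
  set K := ∫ u in Ioo r₂ 4, (Real.sqrt (-f8 u))⁻¹ with hK
  have h12 : A - B = 0 := by
    have : Real.sqrt 2 * (A - B) = 0 := by rw [mul_sub, ← h₁, ← h₂, sub_self]
    rcases mul_eq_zero.mp this with h | h
    · exact absurd h hs
    · exact h
  linear_combination (-1 : ℝ) * h12 + (-(Real.sqrt 2)) * h₁ + (-A) * hs2

/-- Integrability of `1/√(−f)` on `σ' = (r₂, 4)` (transported through `Φ`). [folklore] -/
theorem integrableOn_invSqrt_neg : IntegrableOn (fun u => (Real.sqrt (-f8 u))⁻¹) (Ioo r₂ 4) := by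
  have hS2 : ∀ x ∈ Ioo xs r₂, r₃ < x ∧ x < r₂ ∧ x ≠ xs := fun x hx => ⟨r₃_lt_xs.trans hx.1, hx.2, hx.1.ne'⟩
  have hder : ∀ x ∈ Ioo xs r₂, HasDerivWithinAt Φ (Φ' x) (Ioo xs r₂) x := fun x hx =>
    (hasDerivAt_Φ ((hS2 x hx).2.1.trans r₂_lt_four).ne).hasDerivWithinAt
  have hw : EqOn (fun x => |Φ' x| • (Real.sqrt (-f8 (Φ x)))⁻¹)
      (fun x => Real.sqrt 2 * (Real.sqrt (f8 x))⁻¹) (Ioo xs r₂) :=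
    fun x hx => weight (hS2 x hx).1 (hS2 x hx).2.1 (hS2 x hx).2.2
  have hint := integrableOn_image_iff_integrableOn_abs_deriv_smul measurableSet_Ioo hder Φ_injOn₂
    (fun u => (Real.sqrt (-f8 u))⁻¹)
  rw [Φ_image₂] at hint
  refine hint.mpr ?_
  have h5 : IntegrableOn (fun x => Real.sqrt 2 * (Real.sqrt (f8 x))⁻¹) (Ioo xs r₂) :=
    (integrableOn_invSqrt.mono_set (Ioo_subset_Ioo r₃_lt_xs.le le_rfl)).const_mul (Real.sqrt 2)
  exact h5.congr_fun hw.symm measurableSet_Ioo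

end Summit.KontsevichZagierPeriods.RealEllipticSectorKernel.CM8000

namespace Summit.KontsevichZagierPeriods.RealEllipticSectorKernel.CMPoint8000

open MeasureTheory Set
open Literature.NumberTheory.Transcendental
open Summit.KontsevichZagierPeriods.RealEllipticSectorKernel.Negative
open Summit.KontsevichZagierPeriods.RealEllipticSectorKernel.CM8000
open Summit.KontsevichZagierPeriods.HermiteRigidity.GenusTwoCycleTransferNegative (setIntegral_fin_one)
open Summit.KontsevichZagierPeriods.KontsevichZagierPeriods.Theses.HermiteRigidity (CMTwistPeriodTransfer)

/-- `Δ(120,−224) > 0`. [folklore] -/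
theorem discr_8000_pos : 0 < discr 120 (-224) := by norm_num [discr]

/-- The typed oval at `j = 8000`: `σ = (r₃, r₂)`. [folklore] -/
theorem σ₁_8000 : σ₁ 120 (-224) = {p | r₃ < p 0 ∧ p 0 < r₂} := by
  ext p
  simp only [σ₁, mem_setOf_eq, cubic_eq_f8]
  exact sigma_iff (p 0)

/-- The typed `σ'` at `j = 8000`: `σ' = (r₂, 4)`. [folklore] -/
theorem σ₂_8000 : σ₂ 120 (-224) = {p | r₂ < p 0 ∧ p 0 < 4} := by
  ext p
  simp only [σ₂, mem_setOf_eq, cubic_eq_f8]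
  exact sigma'_iff (p 0)

/-- `J₀(120,−224)` as an integral over `(r₃, r₂) ⊆ ℝ`. [folklore] -/
theorem J₀_8000 : J₀ 120 (-224) = ∫ x in Ioo r₃ r₂, (Real.sqrt (f8 x))⁻¹ := by
  unfold J₀
  rw [σ₁_8000]
  have h := setIntegral_fin_one (fun x => 1 / Real.sqrt (f8 x)) (Ioo r₃ r₂)
  simp only [mem_Ioo] at h
  simp only [cubic_eq_f8]
  rw [h]
  exact integral_congr_ae (Filter.Eventually.of_forall fun x => by simp only [one_div])

/-- `K₀(120,−224)` as an integral over `(r₂, 4) ⊆ ℝ`. [folklore] -/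
theorem K₀_8000 : K₀ 120 (-224) = ∫ u in Ioo r₂ 4, (Real.sqrt (-f8 u))⁻¹ := by
  unfold K₀
  rw [σ₂_8000]
  have h := setIntegral_fin_one (fun x => 1 / Real.sqrt (-f8 x)) (Ioo r₂ 4)
  simp only [mem_Ioo] at h
  simp only [cubic_eq_f8]
  rw [h]
  exact integral_congr_ae (Filter.Eventually.of_forall fun x => by simp only [one_div])

/-- **(F13) `J₀(120,−224) = √2 · K₀(120,−224)`** — the CM period relation of the `j = 8000` curve as
an exact identity of the crux's numbers. [cite: Masser1975, Ch. III Lemma 3.1] -/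
theorem J₀_eq_sqrt2_mul_K₀ : J₀ 120 (-224) = Real.sqrt 2 * K₀ 120 (-224) := by
  rw [J₀_8000, K₀_8000, J_eq_sqrt2_mul_K]

/-- `√2` is a real algebraic number. [folklore] -/
theorem isAlgebraic_sqrt_two : IsAlgebraic ℚ (Real.sqrt 2) := by
  refine IsAlgebraic.of_pow two_pos ?_
  rw [Real.sq_sqrt zero_le_two]
  simpa using isAlgebraic_algebraMap (R := ℚ) (A := ℝ) 2

/-- **(F13) The crux's inlined hypothesis FAILS at the route's own CM test curve `j = 8000`**:
`1·J₀ + (−√2)·K₀ = 0` with algebraic coefficients. So `RealEllipticSectorKernel` is vacuous at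
`(120,−224)` (as the planner intended), while its `ℚ`-sharpening is not refuted there.
[cite: Masser1975, Ch. III Lemma 3.1] -/
theorem not_rigidity_8000 : ¬ Rigidity 120 (-224) := by
  intro h
  have := h 0 1 0 (-Real.sqrt 2) 0 isAlgebraic_zero isAlgebraic_one isAlgebraic_zero
    isAlgebraic_sqrt_two.neg isAlgebraic_zero (by rw [J₀_eq_sqrt2_mul_K₀]; ring)
  exact one_ne_zero this.2.1

/-- **(F13)** The relation at `j = 8000` is NOT an integer one: `(b, d) ↦ bJ₀ + dK₀` vanishes for
integers only at `(0,0)` GIVEN `K₀ ≠ 0` (which holds: `K₀ > 0` below) — because `√2 ∉ ℚ`.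
[folklore] -/
theorem intRelation_J₀_K₀_8000 (hK : K₀ 120 (-224) ≠ 0) (b d : ℤ)
    (h : (b : ℝ) * J₀ 120 (-224) + (d : ℝ) * K₀ 120 (-224) = 0) : b = 0 ∧ d = 0 := by
  rw [J₀_eq_sqrt2_mul_K₀] at h
  have h' : ((b : ℝ) * Real.sqrt 2 + d) * K₀ 120 (-224) = 0 := by linear_combination h
  rcases mul_eq_zero.mp h' with h1 | h1
  · -- `b√2 + d = 0` with integers forces `b = d = 0` (irrationality of `√2`)
    by_cases hb : b = 0
    · subst hb
      simp at h1
      exact ⟨rfl, by exact_mod_cast h1⟩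
    · exfalso
      have hirr := irrational_sqrt_two
      have : Real.sqrt 2 = -(d : ℝ) / b := by
        have hb' : (b : ℝ) ≠ 0 := by exact_mod_cast hb
        field_simp
        linarith
      exact hirr.ne_rat (-(d : ℚ) / b) (by rw [this]; push_cast; ring)
  · exact absurd h1 hK

/-- `K₀(120,−224) > 0` (positive integrand on the non-empty interval `(r₂, 4)`, integrable).
[folklore] -/
theorem K₀_8000_pos : 0 < K₀ 120 (-224) := by
  rw [K₀_8000]
  have hnn : 0 ≤ᵐ[volume.restrict (Ioo r₂ 4)] fun u => (Real.sqrt (-f8 u))⁻¹ :=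
    Filter.Eventually.of_forall fun u => by simp only [Pi.zero_apply]; positivity
  rw [setIntegral_pos_iff_support_of_nonneg_ae hnn integrableOn_invSqrt_neg]
  have hsub : Ioo r₂ 4 ⊆ Function.support (fun u => (Real.sqrt (-f8 u))⁻¹) ∩ Ioo r₂ 4 := by
    intro u hu
    refine ⟨?_, hu⟩
    simp only [Function.mem_support, ne_eq, inv_eq_zero]
    exact (Real.sqrt_pos.mpr (by linarith [f8_neg_of_mem hu.1 hu.2])).ne'
  calc (0 : ENNReal) < volume (Ioo r₂ (4:ℝ)) := by
        rw [Real.volume_Ioo]; exact ENNReal.ofReal_pos.mpr (by linarith [r₂_lt_four])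
    _ ≤ _ := measure_mono hsub

/-- **(F13)** Hence NO integer relation between `J₀` and `K₀` at `j = 8000`. [folklore] -/
theorem intIndependent_J₀_K₀_8000 (b d : ℤ)
    (h : (b : ℝ) * J₀ 120 (-224) + (d : ℝ) * K₀ 120 (-224) = 0) : b = 0 ∧ d = 0 :=
  intRelation_J₀_K₀_8000 K₀_8000_pos.ne' b d h

/-! ### The value identity of support item `CMTwistPeriodTransfer` (stmt-KontsevichZagierPeriods-3415) -/

/-- **(F13) Value identity of item 3415**: for representations `r = [σ', 1/√(−f)]`,
`r' = [σ, 1/(√2√f)]` (`σ' = {f < 0, x > 0} = (r₂,4)`, `σ = {f > 0, x < 4} = (r₃,r₂)`),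
`value r = value r'` — i.e. `K₀ = J₀/√2`. [cite: Masser1975, Ch. III Lemma 3.1] -/
theorem cmTwist_value_eq (r r' : KZ.IntegralRep 1)
    (hr : r.domain = {p | f8 (p 0) < 0 ∧ 0 < p 0})
    (hri : EqOn r.integrand (fun p => 1 / Real.sqrt (-f8 (p 0))) r.domain)
    (hr' : r'.domain = {p | 0 < f8 (p 0) ∧ p 0 < 4})
    (hri' : EqOn r'.integrand (fun p => 1 / (Real.sqrt 2 * Real.sqrt (f8 (p 0)))) r'.domain) :
    r.value = r'.value := by
  have hdom : r.domain = {p : Fin 1 → ℝ | p 0 ∈ Ioo r₂ 4} := by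
    rw [hr]; ext p; simp only [mem_setOf_eq, mem_Ioo]; exact sigma'_iff' (p 0)
  have hdom' : r'.domain = {p : Fin 1 → ℝ | p 0 ∈ Ioo r₃ r₂} := by
    rw [hr']; ext p; simp only [mem_setOf_eq, mem_Ioo]; exact sigma_iff' (p 0)
  have hmeas : MeasurableSet {p : Fin 1 → ℝ | p 0 ∈ Ioo r₂ 4} :=
    measurableSet_Ioo.preimage (measurable_pi_apply 0)
  have hmeas' : MeasurableSet {p : Fin 1 → ℝ | p 0 ∈ Ioo r₃ r₂} :=
    measurableSet_Ioo.preimage (measurable_pi_apply 0)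
  have hv : r.value = ∫ u in Ioo r₂ 4, (Real.sqrt (-f8 u))⁻¹ := by
    unfold KZ.IntegralRep.value
    rw [hdom] at hri ⊢
    rw [setIntegral_congr_fun hmeas hri,
      setIntegral_fin_one (fun x => 1 / Real.sqrt (-f8 x)) (Ioo r₂ 4)]
    exact integral_congr_ae (Filter.Eventually.of_forall fun x => by simp only [one_div])
  have hv' : r'.value = (Real.sqrt 2)⁻¹ * ∫ x in Ioo r₃ r₂, (Real.sqrt (f8 x))⁻¹ := by
    unfold KZ.IntegralRep.value
    rw [hdom'] at hri' ⊢
    rw [setIntegral_congr_fun hmeas' hri',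
      setIntegral_fin_one (fun x => 1 / (Real.sqrt 2 * Real.sqrt (f8 x))) (Ioo r₃ r₂),
      ← integral_const_mul]
    exact integral_congr_ae (Filter.Eventually.of_forall fun x => by simp only [one_div, mul_inv])
  rw [hv, hv', J_eq_sqrt2_mul_K]
  have hs : Real.sqrt 2 ≠ 0 := by positivity
  field_simp

/-- **(F13) The content of `CMTwistPeriodTransfer` (item 3415) follows from the summit** (kernel form
of Conjecture 1, `kzKernelConjecture_iff_isRational`, applied to `[r] − [r']` of value `0`). Stated
with the item UNFOLDED (`f8` is its `f`; `KZ.Equivalent r r'` is `[r] − [r'] ∈ relations`), so that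
this negative-side file proves no route item by name. [cite: KontsevichZagier2001, §1.2] -/
theorem cmTwist_of_summit (h : _root_.KontsevichZagierPeriods) (r r' : KZ.IntegralRep 1)
    (hr : r.domain = {p | f8 (p 0) < 0 ∧ 0 < p 0})
    (hri : EqOn r.integrand (fun p => 1 / Real.sqrt (-f8 (p 0))) {p | f8 (p 0) < 0 ∧ 0 < p 0})
    (hr' : r'.domain = {p | 0 < f8 (p 0) ∧ p 0 < 4})
    (hri' : EqOn r'.integrand (fun p => 1 / (Real.sqrt 2 * Real.sqrt (f8 (p 0))))
      {p | 0 < f8 (p 0) ∧ p 0 < 4}) :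
    KZ.of r - KZ.of r' ∈ KZ.relations := by
  refine (kzKernelConjecture_iff_isRational.mpr h) _ ?_
  rw [map_sub, KZ.eval_of, KZ.eval_of,
    cmTwist_value_eq r r' hr (by rw [hr]; exact hri) hr' (by rw [hr']; exact hri'), sub_self]

/-- **(F13) The route's kill criterion, armed by a theorem**: a proof of `¬CMTwistPeriodTransfer`
(item 3415) refutes the summit. [cite: KontsevichZagier2001, §1.2] -/
theorem not_summit_of_not_cmTwistPeriodTransfer (h : ¬ CMTwistPeriodTransfer) :
    ¬ _root_.KontsevichZagierPeriods :=
  fun hs => h (fun r r' hr hri hr' hri' => cmTwist_of_summit hs r r' hr hri hr' hri')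

end Summit.KontsevichZagierPeriods.RealEllipticSectorKernel.CMPoint8000

/-! ### F14 (cycle 3): the second-kind CM relation at `j = 8000`, `K₁ = √2·J₀ − J₁/√2` -/

namespace Summit.KontsevichZagierPeriods.RealEllipticSectorKernel.CM8000

open MeasureTheory Set

/-- `1/√f` is integrable on the CLOSED oval. [folklore] -/
theorem integrableOn_invSqrt_Icc : IntegrableOn (fun x => (Real.sqrt (f8 x))⁻¹) (Icc r₃ r₂) :=
  (integrableOn_Icc_iff_integrableOn_Ioo).mpr integrableOn_invSqrt

/-- Products of `1/√f` with functions continuous on `[r₃, r₂]` are integrable on the oval. [folklore] -/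
theorem integrableOn_mul_invSqrt {φ : ℝ → ℝ} (hφ : ContinuousOn φ (Icc r₃ r₂)) :
    IntegrableOn (fun x => φ x * (Real.sqrt (f8 x))⁻¹) (Ioo r₃ r₂) :=
  (integrableOn_invSqrt_Icc.continuousOn_mul hφ isCompact_Icc).mono_set Ioo_subset_Icc_self

/-- `f′ = 12x² − 120`. [folklore] -/
theorem hasDerivAt_f8 (x : ℝ) : HasDerivAt f8 (12 * x ^ 2 - 120) x := by
  have h1 : HasDerivAt (fun y : ℝ => y ^ 3) (3 * x ^ 2) x := by simpa using hasDerivAt_pow 3 x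
  have h := ((h1.const_mul 4).sub ((hasDerivAt_id x).const_mul 120)).add_const 224
  exact (h.congr_deriv (by ring)).congr_of_eventuallyEq
    (Filter.Eventually.of_forall fun y => by simp [f8])

/-- The Hermite primitive `G(x) = √f(x)/(x − 4)`. [folklore] -/
def Gfun (x : ℝ) : ℝ := Real.sqrt (f8 x) / (x - 4)

/-- `G′(x) = (2(x − 4) − 36/(x − 4))/√f(x)` on the oval. [folklore] -/
def Gder (x : ℝ) : ℝ := (2 * (x - 4) - 36 / (x - 4)) * (Real.sqrt (f8 x))⁻¹

/-- `G` has derivative `G′` on the open oval. [folklore] -/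
theorem hasDerivAt_Gfun {x : ℝ} (h3 : r₃ < x) (h2 : x < r₂) : HasDerivAt Gfun (Gder x) x := by
  have hfpos : 0 < f8 x := f8_pos_of_mem h3 h2
  set r := Real.sqrt (f8 x) with hr
  have hr0 : 0 < r := Real.sqrt_pos.mpr hfpos
  have hrr : r * r = f8 x := Real.mul_self_sqrt hfpos.le
  have hx4 : x - 4 ≠ 0 := by linarith [r₂_lt_four]
  have h1 : HasDerivAt (fun y => Real.sqrt (f8 y)) ((12 * x ^ 2 - 120) / (2 * r)) x := by
    have := (hasDerivAt_f8 x).sqrt hfpos.ne'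
    simpa [hr] using this
  have h3' : HasDerivAt (fun y : ℝ => y - 4) 1 x := (hasDerivAt_id' x).sub_const 4
  have h4 := h1.div h3' hx4
  refine h4.congr_deriv ?_
  have hrr' : r * r = 4 * x ^ 3 - 120 * x + 224 := by rw [hrr]; rfl
  unfold Gder
  field_simp
  nlinarith [hrr']

/-- `G(r₂) = 0`. [folklore] -/
theorem Gfun_r₂ : Gfun r₂ = 0 := by
  unfold Gfun
  have : f8 r₂ = 0 := by rw [f8_factor]; ring
  rw [this, Real.sqrt_zero, zero_div]

/-- `G(r₃) = 0`. [folklore] -/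
theorem Gfun_r₃ : Gfun r₃ = 0 := by
  unfold Gfun
  have : f8 r₃ = 0 := by rw [f8_factor]; ring
  rw [this, Real.sqrt_zero, zero_div]

/-- `G` is continuous on the closed oval. [folklore] -/
theorem continuousOn_Gfun : ContinuousOn Gfun (Icc r₃ r₂) := by
  unfold Gfun
  refine ContinuousOn.div ?_ (by fun_prop) (fun x hx => by linarith [hx.2, r₂_lt_four])
  have : Continuous fun x => Real.sqrt (f8 x) := by unfold f8; fun_prop
  exact this.continuousOn

/-- `G′` is integrable on the oval. [folklore] -/
theorem integrableOn_Gder : IntegrableOn Gder (Ioo r₃ r₂) := by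
  unfold Gder
  refine integrableOn_mul_invSqrt ?_
  have h : ∀ x ∈ Icc r₃ r₂, x - 4 ≠ 0 := fun x hx => by linarith [hx.2, r₂_lt_four]
  exact ContinuousOn.sub (by fun_prop) (continuousOn_const.div (by fun_prop) h)

/-- **Newton–Leibniz across the branch points**: `∫_{(r₃,r₂)} G′ = G(r₂) − G(r₃) = 0`. [folklore] -/
theorem integral_Gder : ∫ x in Ioo r₃ r₂, Gder x = 0 := by
  have hftc := intervalIntegral.integral_eq_sub_of_hasDerivAt_of_le r₃_lt_r₂.le continuousOn_Gfun
    (fun x hx => hasDerivAt_Gfun hx.1 hx.2)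
    ((intervalIntegrable_iff_integrableOn_Ioo_of_le r₃_lt_r₂.le).mpr integrableOn_Gder)
  rw [Gfun_r₂, Gfun_r₃, sub_zero, intervalIntegral.integral_of_le r₃_lt_r₂.le,
    integral_Ioc_eq_integral_Ioo] at hftc
  exact hftc

/-- **Hermite reduction of `1/((x−4)√f)`**: `18 ∫ dx/((x−4)√f) = J₁ − 4J₀` on the oval
(`36/((x−4)√f) = 2(x−4)/√f − G′`). [cite: BostanLairezSalvy2013, §1] -/
theorem integral_inv_sub_four :
    ∫ x in Ioo r₃ r₂, (x - 4)⁻¹ * (Real.sqrt (f8 x))⁻¹ =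
      ((∫ x in Ioo r₃ r₂, x * (Real.sqrt (f8 x))⁻¹) - 4 * ∫ x in Ioo r₃ r₂, (Real.sqrt (f8 x))⁻¹) / 18 := by
  have h4 : ∀ x ∈ Ioo r₃ r₂, x - 4 ≠ 0 := fun x hx => by linarith [hx.2, r₂_lt_four]
  have hpt : EqOn (fun x => (x - 4)⁻¹ * (Real.sqrt (f8 x))⁻¹)
      (fun x => (2 * x * (Real.sqrt (f8 x))⁻¹ - 8 * (Real.sqrt (f8 x))⁻¹ - Gder x) / 36) (Ioo r₃ r₂) := by
    intro x hx
    have hx4 := h4 x hx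
    simp only [Gder]
    field_simp
    ring
  rw [setIntegral_congr_fun measurableSet_Ioo hpt, integral_div]
  have i1 : IntegrableOn (fun x => 2 * x * (Real.sqrt (f8 x))⁻¹) (Ioo r₃ r₂) :=
    integrableOn_mul_invSqrt (by fun_prop)
  have i2 : IntegrableOn (fun x => 8 * (Real.sqrt (f8 x))⁻¹) (Ioo r₃ r₂) :=
    integrableOn_mul_invSqrt (by fun_prop)
  have i12 : IntegrableOn (fun x => 2 * x * (Real.sqrt (f8 x))⁻¹ - 8 * (Real.sqrt (f8 x))⁻¹)
      (Ioo r₃ r₂) := i1.sub i2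
  rw [integral_sub i12 integrableOn_Gder, integral_sub i1 i2, integral_Gder]
  have e1 : ∫ x in Ioo r₃ r₂, 2 * x * (Real.sqrt (f8 x))⁻¹ = 2 * ∫ x in Ioo r₃ r₂, x * (Real.sqrt (f8 x))⁻¹ := by
    rw [← integral_const_mul]
    exact integral_congr_ae (Filter.Eventually.of_forall fun x => by ring)
  have e2 : ∫ x in Ioo r₃ r₂, 8 * (Real.sqrt (f8 x))⁻¹ = 8 * ∫ x in Ioo r₃ r₂, (Real.sqrt (f8 x))⁻¹ :=
    integral_const_mul _ _
  rw [e1, e2]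
  ring

/-- `∫_{oval} Φ(x) dx/√f = 2J₀ − J₁` (`Φ = −x/2 − 9/(x−4)` and the Hermite reduction). [folklore] -/
theorem integral_Φ_mul :
    ∫ x in Ioo r₃ r₂, Φ x * (Real.sqrt (f8 x))⁻¹ =
      2 * (∫ x in Ioo r₃ r₂, (Real.sqrt (f8 x))⁻¹) - ∫ x in Ioo r₃ r₂, x * (Real.sqrt (f8 x))⁻¹ := by
  have hpt : EqOn (fun x => Φ x * (Real.sqrt (f8 x))⁻¹)
      (fun x => -(1 / 2) * (x * (Real.sqrt (f8 x))⁻¹) - 9 * ((x - 4)⁻¹ * (Real.sqrt (f8 x))⁻¹))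
      (Ioo r₃ r₂) := by
    intro x hx
    simp only [Φ, div_eq_mul_inv]
    ring
  have i1 : IntegrableOn (fun x => x * (Real.sqrt (f8 x))⁻¹) (Ioo r₃ r₂) :=
    integrableOn_mul_invSqrt (by fun_prop)
  have i2 : IntegrableOn (fun x => (x - 4)⁻¹ * (Real.sqrt (f8 x))⁻¹) (Ioo r₃ r₂) :=
    integrableOn_mul_invSqrt (ContinuousOn.inv₀ (by fun_prop)
      (fun x hx => by linarith [hx.2, r₂_lt_four]))
  rw [setIntegral_congr_fun measurableSet_Ioo hpt, integral_sub (i1.const_mul _) (i2.const_mul _),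
    integral_const_mul, integral_const_mul, integral_inv_sub_four]
  ring

/-- Pull-back of the second-kind form through `Φ`, one half at a time:
`∫_{σ'} u du/√(−f) = √2 ∫_{half} Φ(x) dx/√f`. [folklore] -/
theorem integral_half_second {S : Set ℝ} (hS : MeasurableSet S) (himg : Φ '' S = Ioo r₂ 4)
    (hinj : InjOn Φ S) (hS2 : ∀ x ∈ S, r₃ < x ∧ x < r₂ ∧ x ≠ xs) :
    ∫ u in Ioo r₂ 4, u * (Real.sqrt (-f8 u))⁻¹ =
      Real.sqrt 2 * ∫ x in S, Φ x * (Real.sqrt (f8 x))⁻¹ := by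
  have hder : ∀ x ∈ S, HasDerivWithinAt Φ (Φ' x) S x := fun x hx =>
    (hasDerivAt_Φ ((hS2 x hx).2.1.trans r₂_lt_four).ne).hasDerivWithinAt
  have hw : EqOn (fun x => |Φ' x| • (Φ x * (Real.sqrt (-f8 (Φ x)))⁻¹))
      (fun x => Real.sqrt 2 * (Φ x * (Real.sqrt (f8 x))⁻¹)) S := by
    intro x hx
    have h := weight (hS2 x hx).1 (hS2 x hx).2.1 (hS2 x hx).2.2
    simp only [smul_eq_mul] at h ⊢
    calc |Φ' x| * (Φ x * (Real.sqrt (-f8 (Φ x)))⁻¹) = Φ x * (|Φ' x| * (Real.sqrt (-f8 (Φ x)))⁻¹) := by ring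
      _ = Φ x * (Real.sqrt 2 * (Real.sqrt (f8 x))⁻¹) := by rw [h]
      _ = Real.sqrt 2 * (Φ x * (Real.sqrt (f8 x))⁻¹) := by ring
  have key := integral_image_eq_integral_abs_deriv_smul hS hder hinj
    (fun u => u * (Real.sqrt (-f8 u))⁻¹)
  rw [himg, setIntegral_congr_fun hS hw, integral_const_mul] at key
  exact key

/-- **(F14) The second-kind CM relation at `j = 8000`**:
`∫_{(r₂,4)} u du/√(−f) = (√2/2)(2J₀ − J₁)` with `J₀ = ∫_{(r₃,r₂)} dx/√f`, `J₁ = ∫_{(r₃,r₂)} x dx/√f`,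
i.e. `K₁ = √2J₀ − J₁/√2` (Masser's Lemma 3.1 with `κ ≠ 0`) — by the same real isogeny plus ONE
Hermite (Newton–Leibniz) step, no transcendence. [cite: Masser1975, Ch. III Lemma 3.1] -/
theorem K1_eq :
    ∫ u in Ioo r₂ 4, u * (Real.sqrt (-f8 u))⁻¹ =
      Real.sqrt 2 / 2 * (2 * (∫ x in Ioo r₃ r₂, (Real.sqrt (f8 x))⁻¹) -
        ∫ x in Ioo r₃ r₂, x * (Real.sqrt (f8 x))⁻¹) := by
  have h₁ := integral_half_second measurableSet_Ioo Φ_image₁ Φ_injOn₁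
    (fun x hx => ⟨hx.1, hx.2.trans xs_lt_r₂, hx.2.ne⟩)
  have h₂ := integral_half_second measurableSet_Ioo Φ_image₂ Φ_injOn₂
    (fun x hx => ⟨r₃_lt_xs.trans hx.1, hx.2, hx.1.ne'⟩)
  rw [← integral_Φ_mul]
  have hsplit : Ioo r₃ r₂ = Ioc r₃ xs ∪ Ioo xs r₂ := (Ioc_union_Ioo_eq_Ioo r₃_lt_xs.le xs_lt_r₂).symm
  have hdisj : Disjoint (Ioc r₃ xs) (Ioo xs r₂) := by
    rw [Set.disjoint_iff]; rintro x ⟨h1, h2⟩; exact (lt_irrefl _ (h1.2.trans_lt h2.1)).elim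
  have hint : IntegrableOn (fun x => Φ x * (Real.sqrt (f8 x))⁻¹) (Ioo r₃ r₂) :=
    integrableOn_mul_invSqrt (continuousOn_Φ (fun x hx => by linarith [hx.2, r₂_lt_four]))
  rw [hsplit, setIntegral_union hdisj measurableSet_Ioo
    (hint.mono_set (by rw [hsplit]; exact subset_union_left))
    (hint.mono_set (by rw [hsplit]; exact subset_union_right)), integral_Ioc_eq_integral_Ioo]
  have hs2 : Real.sqrt 2 * Real.sqrt 2 = 2 := Real.mul_self_sqrt zero_le_two
  have hs : Real.sqrt 2 ≠ 0 := by positivity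
  set A := ∫ x in Ioo r₃ xs, Φ x * (Real.sqrt (f8 x))⁻¹ with hA
  set B := ∫ x in Ioo xs r₂, Φ x * (Real.sqrt (f8 x))⁻¹ with hB
  set K := ∫ u in Ioo r₂ 4, u * (Real.sqrt (-f8 u))⁻¹ with hK
  have h12 : A - B = 0 := by
    have : Real.sqrt 2 * (A - B) = 0 := by rw [mul_sub, ← h₁, ← h₂, sub_self]
    rcases mul_eq_zero.mp this with h | h
    · exact absurd h hs
    · exact h
  have hKA : K = Real.sqrt 2 * A := h₁
  have : Real.sqrt 2 / 2 * (A + B) = Real.sqrt 2 * A := by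
    have hAB : B = A := by linarith
    rw [hAB]; ring
  rw [this, ← hKA]

end Summit.KontsevichZagierPeriods.RealEllipticSectorKernel.CM8000

namespace Summit.KontsevichZagierPeriods.RealEllipticSectorKernel.CMPoint8000

open MeasureTheory Set
open Literature.NumberTheory.Transcendental
open Summit.KontsevichZagierPeriods.RealEllipticSectorKernel.Negative
open Summit.KontsevichZagierPeriods.RealEllipticSectorKernel.CM8000
open Summit.KontsevichZagierPeriods.HermiteRigidity.GenusTwoCycleTransferNegative (setIntegral_fin_one)
open Summit.KontsevichZagierPeriods.KontsevichZagierPeriods.Theses.HermiteRigidity (CMTwistQuasiPeriodTransfer)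

/-- `J₁(120,−224)` as an integral over `(r₃, r₂) ⊆ ℝ`. [folklore] -/
theorem J₁_8000 : J₁ 120 (-224) = ∫ x in Ioo r₃ r₂, x * (Real.sqrt (f8 x))⁻¹ := by
  unfold J₁
  rw [σ₁_8000]
  have h := setIntegral_fin_one (fun x => x / Real.sqrt (f8 x)) (Ioo r₃ r₂)
  simp only [mem_Ioo] at h
  simp only [cubic_eq_f8]
  rw [h]
  exact integral_congr_ae (Filter.Eventually.of_forall fun x => by simp only [div_eq_mul_inv])

/-- `K₁(120,−224)` as an integral over `(r₂, 4) ⊆ ℝ`. [folklore] -/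
theorem K₁_8000 : K₁ 120 (-224) = ∫ u in Ioo r₂ 4, u * (Real.sqrt (-f8 u))⁻¹ := by
  unfold K₁
  rw [σ₂_8000]
  have h := setIntegral_fin_one (fun x => x / Real.sqrt (-f8 x)) (Ioo r₂ 4)
  simp only [mem_Ioo] at h
  simp only [cubic_eq_f8]
  rw [h]
  exact integral_congr_ae (Filter.Eventually.of_forall fun x => by simp only [div_eq_mul_inv])

/-- **(F14) `K₁(120,−224) = √2·J₀(120,−224) − (√2/2)·J₁(120,−224)`** — the second-kind CM relation
at `j = 8000`, exact. [cite: Masser1975, Ch. III Lemma 3.1] -/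
theorem K₁_eq_8000 :
    K₁ 120 (-224) = Real.sqrt 2 * J₀ 120 (-224) - Real.sqrt 2 / 2 * J₁ 120 (-224) := by
  rw [K₁_8000, J₀_8000, J₁_8000, K1_eq]; ring

/-- **(F14) A second, independent failure at `j = 8000`, not involving `J₀`**: `1, J₁, K₀, K₁` are
linearly DEPENDENT over the real algebraic numbers, `(√2/2)·J₁ − 2·K₀ + K₁ = 0` (trade `√2J₀ = 2K₀`
in `K₁ = √2J₀ − J₁/√2`). With F13's `(0, 1, 0, −√2, 0)` this spans a 2-dimensional space of relations
with irrational algebraic coefficients. [cite: Masser1975, Ch. III Lemma 3.1] -/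
theorem not_rigid_one_J₁_K₀_K₁_8000 :
    ¬ ∀ a c d e : ℝ, IsAlgebraic ℚ a → IsAlgebraic ℚ c → IsAlgebraic ℚ d → IsAlgebraic ℚ e →
      a + c * J₁ 120 (-224) + d * K₀ 120 (-224) + e * K₁ 120 (-224) = 0 →
        a = 0 ∧ c = 0 ∧ d = 0 ∧ e = 0 := by
  intro h
  have htwo : IsAlgebraic ℚ (2 : ℝ) := by simpa using isAlgebraic_algebraMap (R := ℚ) (A := ℝ) 2
  have hc : IsAlgebraic ℚ (Real.sqrt 2 / 2) := by
    rw [div_eq_mul_inv]; exact isAlgebraic_sqrt_two.mul htwo.inv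
  have h2 := h 0 (Real.sqrt 2 / 2) (-2) 1 isAlgebraic_zero hc htwo.neg isAlgebraic_one (by
      rw [K₁_eq_8000, J₀_eq_sqrt2_mul_K₀]
      have hs2 : Real.sqrt 2 * Real.sqrt 2 = 2 := Real.mul_self_sqrt zero_le_two
      linear_combination (K₀ 120 (-224)) * hs2)
  norm_num at h2

/-- **(F14)** In particular the crux's inlined hypothesis fails at `(120,−224)` through the second
kind as well: the vector `(0, 0, √2/2, −2, 1)` (`J₁`, `K₀`, `K₁` only). [cite: Masser1975, Ch. III Lemma 3.1] -/
theorem not_rigidity_8000' : ¬ Rigidity 120 (-224) := by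
  intro h
  have htwo : IsAlgebraic ℚ (2 : ℝ) := by simpa using isAlgebraic_algebraMap (R := ℚ) (A := ℝ) 2
  have hc : IsAlgebraic ℚ (Real.sqrt 2 / 2) := by
    rw [div_eq_mul_inv]; exact isAlgebraic_sqrt_two.mul htwo.inv
  have h2 := h 0 0 (Real.sqrt 2 / 2) (-2) 1 isAlgebraic_zero isAlgebraic_zero hc (htwo.neg)
    isAlgebraic_one (by
      rw [K₁_eq_8000, J₀_eq_sqrt2_mul_K₀]
      have hs2 : Real.sqrt 2 * Real.sqrt 2 = 2 := Real.mul_self_sqrt zero_le_two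
      linear_combination (K₀ 120 (-224)) * hs2)
  norm_num at h2

/-! ### The value identity of support item `CMTwistQuasiPeriodTransfer` (stmt-KontsevichZagierPeriods-3416) -/

/-- Value of a representation with domain `σ = {f > 0, x < 4}` and integrand `EqOn` a multiple-type
function of `x` over `√f`: reduction to an integral over `(r₃, r₂)`. [folklore] -/
theorem value_σ_eq (t : KZ.IntegralRep 1) (g : ℝ → ℝ) (ht : t.domain = {p | 0 < f8 (p 0) ∧ p 0 < 4})
    (hti : EqOn t.integrand (fun p => g (p 0)) t.domain) :
    t.value = ∫ x in Ioo r₃ r₂, g x := by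
  have hdom : t.domain = {p : Fin 1 → ℝ | p 0 ∈ Ioo r₃ r₂} := by
    rw [ht]; ext p; simp only [mem_setOf_eq, mem_Ioo]; exact sigma_iff' (p 0)
  have hmeas : MeasurableSet {p : Fin 1 → ℝ | p 0 ∈ Ioo r₃ r₂} :=
    measurableSet_Ioo.preimage (measurable_pi_apply 0)
  unfold KZ.IntegralRep.value
  rw [hdom] at hti ⊢
  rw [setIntegral_congr_fun hmeas hti, setIntegral_fin_one g (Ioo r₃ r₂)]

/-- Likewise for `σ' = {f < 0, x > 0} = (r₂, 4)`. [folklore] -/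
theorem value_σ'_eq (t : KZ.IntegralRep 1) (g : ℝ → ℝ) (ht : t.domain = {p | f8 (p 0) < 0 ∧ 0 < p 0})
    (hti : EqOn t.integrand (fun p => g (p 0)) t.domain) :
    t.value = ∫ x in Ioo r₂ 4, g x := by
  have hdom : t.domain = {p : Fin 1 → ℝ | p 0 ∈ Ioo r₂ 4} := by
    rw [ht]; ext p; simp only [mem_setOf_eq, mem_Ioo]; exact sigma'_iff' (p 0)
  have hmeas : MeasurableSet {p : Fin 1 → ℝ | p 0 ∈ Ioo r₂ 4} :=
    measurableSet_Ioo.preimage (measurable_pi_apply 0)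
  unfold KZ.IntegralRep.value
  rw [hdom] at hti ⊢
  rw [setIntegral_congr_fun hmeas hti, setIntegral_fin_one g (Ioo r₂ 4)]

/-- **(F14) Value identity of item 3416**: for `r = [σ', x/√(−f)]`, `s = [σ, √2/√f]`,
`t = [σ, −x/(√2√f)]`: `value r − value s − value t = 0` (`K₁ − √2J₀ + J₁/√2 = 0`).
[cite: Masser1975, Ch. III Lemma 3.1] -/
theorem cmTwistQuasi_value_eq (r s t : KZ.IntegralRep 1)
    (hr : r.domain = {p | f8 (p 0) < 0 ∧ 0 < p 0})
    (hri : EqOn r.integrand (fun p => p 0 / Real.sqrt (-f8 (p 0))) r.domain)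
    (hs : s.domain = {p | 0 < f8 (p 0) ∧ p 0 < 4})
    (hsi : EqOn s.integrand (fun p => Real.sqrt 2 / Real.sqrt (f8 (p 0))) s.domain)
    (ht : t.domain = {p | 0 < f8 (p 0) ∧ p 0 < 4})
    (hti : EqOn t.integrand (fun p => -p 0 / (Real.sqrt 2 * Real.sqrt (f8 (p 0)))) t.domain) :
    r.value - s.value - t.value = 0 := by
  rw [value_σ'_eq r (fun x => x / Real.sqrt (-f8 x)) hr hri,
    value_σ_eq s (fun x => Real.sqrt 2 / Real.sqrt (f8 x)) hs hsi,
    value_σ_eq t (fun x => -x / (Real.sqrt 2 * Real.sqrt (f8 x))) ht hti]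
  have e1 : ∫ x in Ioo r₂ 4, x / Real.sqrt (-f8 x) = ∫ u in Ioo r₂ 4, u * (Real.sqrt (-f8 u))⁻¹ :=
    integral_congr_ae (Filter.Eventually.of_forall fun x => by simp only [div_eq_mul_inv])
  have e2 : ∫ x in Ioo r₃ r₂, Real.sqrt 2 / Real.sqrt (f8 x) =
      Real.sqrt 2 * ∫ x in Ioo r₃ r₂, (Real.sqrt (f8 x))⁻¹ := by
    rw [← integral_const_mul]
    exact integral_congr_ae (Filter.Eventually.of_forall fun x => by simp only [div_eq_mul_inv])
  have e3 : ∫ x in Ioo r₃ r₂, -x / (Real.sqrt 2 * Real.sqrt (f8 x)) =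
      -(Real.sqrt 2)⁻¹ * ∫ x in Ioo r₃ r₂, x * (Real.sqrt (f8 x))⁻¹ := by
    rw [← integral_const_mul]
    exact integral_congr_ae (Filter.Eventually.of_forall fun x => by
      simp only [div_eq_mul_inv, mul_inv]; ring)
  have hs0 : Real.sqrt 2 ≠ 0 := by positivity
  have hs2 : Real.sqrt 2 * Real.sqrt 2 = 2 := Real.mul_self_sqrt zero_le_two
  have hinv : (Real.sqrt 2)⁻¹ = Real.sqrt 2 / 2 := by
    rw [inv_eq_iff_eq_inv, inv_div, eq_div_iff hs0]; exact hs2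
  rw [e1, e2, e3, K1_eq, hinv]
  ring

/-- **(F14) The content of `CMTwistQuasiPeriodTransfer` (item 3416) follows from the summit**, stated
with the item unfolded (no route item is proved by name here). [cite: KontsevichZagier2001, §1.2] -/
theorem cmTwistQuasi_of_summit (h : _root_.KontsevichZagierPeriods) (r s t : KZ.IntegralRep 1)
    (hr : r.domain = {p | f8 (p 0) < 0 ∧ 0 < p 0})
    (hri : EqOn r.integrand (fun p => p 0 / Real.sqrt (-f8 (p 0))) {p | f8 (p 0) < 0 ∧ 0 < p 0})
    (hs : s.domain = {p | 0 < f8 (p 0) ∧ p 0 < 4})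
    (hsi : EqOn s.integrand (fun p => Real.sqrt 2 / Real.sqrt (f8 (p 0))) {p | 0 < f8 (p 0) ∧ p 0 < 4})
    (ht : t.domain = {p | 0 < f8 (p 0) ∧ p 0 < 4})
    (hti : EqOn t.integrand (fun p => -p 0 / (Real.sqrt 2 * Real.sqrt (f8 (p 0))))
      {p | 0 < f8 (p 0) ∧ p 0 < 4}) :
    KZ.of r - KZ.of s - KZ.of t ∈ KZ.relations := by
  refine (kzKernelConjecture_iff_isRational.mpr h) _ ?_
  rw [map_sub, map_sub, KZ.eval_of, KZ.eval_of, KZ.eval_of]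
  exact cmTwistQuasi_value_eq r s t hr (by rw [hr]; exact hri) hs (by rw [hs]; exact hsi) ht
    (by rw [ht]; exact hti)

/-- **(F14) Kill criterion, second kind**: a proof of `¬CMTwistQuasiPeriodTransfer` (item 3416)
refutes the summit. [cite: KontsevichZagier2001, §1.2] -/
theorem not_summit_of_not_cmTwistQuasiPeriodTransfer (h : ¬ CMTwistQuasiPeriodTransfer) :
    ¬ _root_.KontsevichZagierPeriods :=
  fun hsum => h (fun r s t hr hri hs hsi ht hti => cmTwistQuasi_of_summit hsum r s t hr hri hs hsi ht hti)

end Summit.KontsevichZagierPeriods.RealEllipticSectorKernel.CMPoint8000
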